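import Mathlib
import Literature.Algebra.Polynomial.SosConvexHessian
import Literature.Algebra.Polynomial.PutinarPositivstellensatz
import HarnessLib

/-!
# SOS-convexity: the Helton–Nie integral lemma, Lasserre's Jensen inequality for pseudo-moment
# functionals, and exactness of the first Putinar relaxation for SOS-convex programs
# (Lasserre 2009, Lemmas 2.4–2.5, Theorem 2.6, Theorem 3.3 (a); Helton–Nie 2010)

Topic `Literature/Algebra/Polynomial`, namespace `Literature.Algebra.Polynomial.SosConvexExactness`.
Continues the tree's `SosConvexHessian.lean` (`hessian p`, `IsSosConvex p` = «`∇²p` is an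
SOS-matrix», Blekherman–Parrilo–Thomas Def. 3.86) and `SosMatrix.lean` (`IsSosMatrix`).

## Source, read on the page

J. B. Lasserre, *Convexity in semialgebraic geometry and polynomial optimization*, SIAM J. Optim.
19 (2009) 1995–2014 [held text `paper:arxiv-0806.3784`, chunks p0005–p0008]:
* **Definition 2.3 (Helton and Nie).** «A polynomial `f ∈ ℝ[X]_{2d}` is said to be SOS-convex if
  `∇²f` is SOS, that is, `∇²f = L Lᵀ` for some real matrix polynomial `L ∈ ℝ[X]^{n×s}`.»
* **Lemma 2.4 (Helton and Nie).** «If a symmetric matrix polynomial `P ∈ ℝ[X]^{r×r}` is SOS then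
  for any `u ∈ ℝⁿ`, the double integral `X ↦ F(X,u) := ∫₀¹ ∫₀ᵗ P(u + s(X − u)) ds dt` is also a
  symmetric SOS matrix polynomial in `ℝ[X]^{r×r}`.»
* **Lemma 2.5 (Helton and Nie).** «For a polynomial `f ∈ ℝ[X]` and every `x, u ∈ ℝⁿ`:
  `f(x) = f(u) + ∇f(u)ᵀ(x − u) + (x − u)ᵀ F(x,u) (x − u)`,
  `F(x,u) = ∫₀¹∫₀ᵗ ∇²f(u + s(x − u)) ds dt`.  And so if `f` is SOS-convex and `f(u) = 0`,
  `∇f(u) = 0`, then `f` is a SOS polynomial.»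
* **Theorem 2.6.** «Let `f ∈ ℝ[X]_{2d}` be SOS-convex, and let `y = (y_α)` satisfy `y₀ = 1` and
  `M_d(y) ⪰ 0`. Then `L_y(f(X)) ≥ f(L_y(X))`, where `L_y(X) = (L_y(X₁), …, L_y(Xₙ))`.»  Proof:
  `f(X) − f(z) = ⟨∇f(z), X − z⟩ + ⟨X − z, F(X)(X − z)⟩` with `Δ(X) := ⟨X − z, F(X)(X − z)⟩ ∈ Σ²[X]`,
  so `L_y(f) − f(z) ≥ ⟨∇f(z), L_y(X) − z⟩`; take `z := L_y(X)`.
* **Theorem 3.3.** «Let `K` be as in (2.2) and Slater's condition hold. Let `f ∈ ℝ[X]` be such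
  that `f* := inf {f(x) : x ∈ K} = f(x*)` for some `x* ∈ K`. If `f` is SOS-convex and `−g_j` is
  SOS-convex for every `j = 1,…,m`, then: (a) `f − f* ∈ Q_c(g)`. (b) The simplified
  SDP-relaxation … and its dual are exact and solvable.»  Here (p0007)
  `Q_c(g) = {σ₀ + Σ_j λ_j g_j : σ₀ ∈ Σ²[X], λ ∈ ℝ^m_+}` («a convex (weak) version of … Putinar's
  Positivstellensatz where one replaces the quadratic module `Q(g)` with its subset `Q_c(g)`»).
  The proof of (a) (Lasserre, *Convex sets with semidefinite representation*, ref.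
  [lasserre-convex]; reproduced in the proof of Theorem 3.4 on p0008): at a KKT pair `(x*, λ)` —
  which exists by Slater — the Lagrangian `L = f − f* − Σ_j λ_j g_j` is SOS-convex with
  `L(x*) = 0`, `∇L(x*) = 0`, hence SOS by Lemma 2.5.

(Lemmas 2.4/2.5 are J. W. Helton, J. Nie, *Semidefinite representation of convex sets*, Math.
Program. 122 (2010) 21–64, Lemmas 7–8 [HN1 of the source]; cited through Lasserre's text.)

## What is formalised (all proved; no named facts)

Over `MvPolynomial σ ℝ` with `σ` a `Fintype`; the auxiliary variable `s` of the line
`u + s(X − u)` lives in `Polynomial (MvPolynomial σ ℝ)`.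
* §1 `dblWeight m = 1/((m+1)(m+2))` (`= ∫₀¹∫₀ᵗ s^m ds dt`), the `ℝ[X]`-linear functional
  `dblInt : ℝ[X][s] → ℝ[X]`, `Σ a_m s^m ↦ Σ a_m/((m+1)(m+2))` — the double integral `∫₀¹∫₀ᵗ · ds dt`
  computed coefficientwise (`dblInt_monomial`; its value on `s^m` is the printed integral:
  `integral_dblWeight`) — and the second-order Taylor formula with this remainder,
  `eval_one_eq_taylor`: `φ(1) = φ(0) + φ'(0) + ∫₀¹∫₀ᵗ φ''`.
* §2 `lineSubst u : f ↦ f(u + s(X − u))` with `eval` at `s = 1` (`= f`), at `s = 0` (`= f(u)`),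
  and the chain rule `derivative_lineSubst` (`(d/ds) f(u + s(X−u)) = Σ_i (∂_i f)(u + s(X−u))·(X_i − u_i)`).
* §3 ★ **Lemma 2.5** `eq_taylor_hessian`: `f = f(u) + Σ_i ∂_i f(u)(X_i − u_i) + (X−u)ᵀ F (X−u)`
  with `F = taylorMatrix f u := dblInt ∘ lineSubst u` applied entrywise to `hessian f`.
* §4 ★ **Lemma 2.4** `isSosMatrix_dblInt_lineSubst`: `P` an SOS-matrix ⇒ `∫₀¹∫₀ᵗ P(u + s(X−u))`
  is an SOS-matrix.  Proof as one would do it by hand: `P = AᵀA`, expand `A(u + s(X−u)) = Σ_k s^k A_k`,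
  so the integral is `Σ_{k,l} H_{kl} A_kᵀ A_l` with `H_{kl} = 1/((k+l+1)(k+l+2)) = ∫₀¹ (1−s) s^{k+l} ds`;
  `H` is positive semidefinite (`posSemidef_dblWeightMatrix`: `cᵀHc = ∫₀¹ (1−s)(Σ c_k s^k)² ds ≥ 0`),
  hence `H = GᵀG` and the integral is `Σ_j (Σ_k G_{jk} A_k)ᵀ(Σ_k G_{jk} A_k)`.
* §5 ★★ `IsSosConvex.isSumSq_taylorRemainder` — for SOS-convex `f` and every `u`,
  `f − f(u) − Σ_i ∂_i f(u)(X_i − u_i)` is a sum of squares; **Lemma 2.5's conclusion**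
  `IsSosConvex.isSumSq_of_eval_eq_zero` (`f(u) = 0`, `∇f(u) = 0` ⇒ `f` SOS);
  ★★ **Theorem 2.6** `IsSosConvex.jensen` for linear functionals `L` on `ℝ[X]` with `L(1) = 1`
  and `L ≥ 0` on sums of squares: `L(f) ≥ f(L(X₁),…,L(Xₙ))`.
* §6 ★★ **Theorem 3.3 (a)** `IsSosConvex.sub_C_mem_convexCone_of_kkt`: `f`, `−g_j` SOS-convex,
  `(x*, λ)` a KKT pair (`λ_j ≥ 0`, `λ_j g_j(x*) = 0`, `∇f(x*) = Σ_j λ_j ∇g_j(x*)`; feasibility of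
  `x*` is not needed for (a)) ⇒ `f − f(x*) = σ₀ + Σ_j λ_j g_j` with `σ₀` SOS, i.e.
  `f − f(x*) ∈ Q_c(g)` (`convexCone g`); hence `f − f(x*) ∈ M(g)` (the tree's `quadraticModule`,
  `sub_C_mem_quadraticModule_of_kkt`) and `f(x*) ≤ f` on `K` (`eval_le_of_kkt`: the certificate
  proves global optimality of a feasible KKT point).  Also the Hessian calculus `hessian_neg` / `_sum` / `_C_mul` / `_C` and the closure properties `IsSosConvex.add` / `.const_mul` /
  `.sum` / `.add_C` / `.lagrangian` (all in the namespace of the tree's `IsSosConvex`, so that dot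
  notation works).

## References

* [Lasserre2009] J. B. Lasserre, *Convexity in semialgebraic geometry and polynomial
  optimization*, SIAM J. Optim. 19 (2009) 1995–2014, doi:10.1137/080728214 (arXiv:0806.3784) —
  Def. 2.3, Lemmas 2.4–2.5, Thm 2.6, §3.1 (`Q_c(g)`), Thm 3.3.
* [HeltonNie2008] J. W. Helton, J. Nie, *Semidefinite representation of convex sets*, Math.
  Program. 122 (2010) 21–64, doi:10.1007/s10107-008-0240-y — the origin of Lemmas 2.4/2.5
  (cited through [Lasserre2009]).

## Declared deviations

* Theorem 2.6 is proved for functionals nonnegative on ALL sums of squares of `ℝ[X]` (the printed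
  hypothesis `M_d(y) ⪰ 0` only asks this for squares of degree `≤ d`, `2d ≥ deg f`; the SOS
  certificate produced by Lemma 2.4 has squares of degree `≤ d`, but degrees are not tracked
  here) — TODO(general form): the truncated statement.
* Theorem 3.3 (a) is proved from a KKT pair, which is what the printed proof uses; the existence of
  the multipliers under Slater's condition (convex Lagrange duality) is not formalised, and (b)
  (solvability of the SDP pair) is represented by the algebraic certificate `f − f* ∈ Q_c(g) ⊆ M(g)`
  together with its soundness `f* ≤ f` on `K`.
-/

noncomputable section

open MvPolynomial Matrix Finset

open scoped Polynomial BigOperators MatrixOrder ComplexOrder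

namespace Literature.Algebra.Polynomial.SosConvexExactness

open Literature.Algebra.Polynomial.SosMatrix
open Literature.Algebra.Polynomial.SosConvexHessian (hessian hessian_apply IsSosConvex)
open Literature.Algebra.Polynomial.PutinarPositivstellensatz (quadraticModule semialgSet
  eval_nonneg_of_mem_quadraticModule)

variable {σ : Type*}

/-! ### §1 The double integral `∫₀¹∫₀ᵗ · ds dt` on `ℝ[X][s]`, coefficientwise -/

/-- `∫₀¹ ∫₀ᵗ s^m ds dt = 1/((m+1)(m+2))`. [cite: Lasserre2009, Lemma 2.4] -/
def dblWeight (m : ℕ) : ℝ := 1 / (((m : ℝ) + 1) * ((m : ℝ) + 2))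

/-- [cite: Lasserre2009, Lemma 2.4] -/
theorem dblWeight_pos (m : ℕ) : 0 < dblWeight m := by
  unfold dblWeight
  positivity

/-- The printed double integral of `s^m`: `∫₀¹ (∫₀ᵗ s^m ds) dt = 1/((m+1)(m+2))`.
[cite: Lasserre2009, Lemma 2.4] -/
theorem integral_dblWeight (m : ℕ) :
    ∫ t in (0 : ℝ)..1, (∫ s in (0 : ℝ)..t, s ^ m) = dblWeight m := by
  have h1 : ∀ t : ℝ, ∫ s in (0 : ℝ)..t, s ^ m = t ^ (m + 1) / (m + 1) := by
    intro t
    rw [integral_pow]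
    simp
  simp_rw [h1]
  rw [intervalIntegral.integral_div, integral_pow]
  have h2 : ((m : ℝ) + 1) ≠ 0 := by positivity
  have h3 : ((m : ℝ) + 1 + 1) ≠ 0 := by positivity
  unfold dblWeight
  field_simp
  push_cast
  ring

/-- «`∫₀¹∫₀ᵗ s^m ds dt = ∫₀¹ (1 − s) s^m ds`» — the weight as a single integral (used for the
positive semidefiniteness of the moment matrix `(dblWeight (k+l))_{k,l}`).
[cite: Lasserre2009, Lemma 2.4] -/
theorem integral_one_sub_mul_pow (m : ℕ) :
    ∫ s in (0 : ℝ)..1, (1 - s) * s ^ m = dblWeight m := by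
  have h : ∀ s : ℝ, (1 - s) * s ^ m = s ^ m - s ^ (m + 1) := fun s => by ring
  simp_rw [h]
  rw [intervalIntegral.integral_sub ((continuous_pow m).intervalIntegrable _ _)
    ((continuous_pow (m + 1)).intervalIntegrable _ _), integral_pow, integral_pow]
  have h2 : ((m : ℝ) + 1) ≠ 0 := by positivity
  have h3 : ((m : ℝ) + 1 + 1) ≠ 0 := by positivity
  unfold dblWeight
  field_simp
  push_cast
  ring

/-- The double integral `∫₀¹∫₀ᵗ · ds dt : ℝ[X][s] → ℝ[X]`, computed coefficientwise
(`Σ_m a_m s^m ↦ Σ_m a_m /((m+1)(m+2))`); it is `ℝ[X]`-linear.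
[cite: Lasserre2009, Lemma 2.4] -/
def dblInt : Polynomial (MvPolynomial σ ℝ) →ₗ[MvPolynomial σ ℝ] MvPolynomial σ ℝ :=
  Polynomial.lsum fun m => LinearMap.mulLeft (MvPolynomial σ ℝ) (C (dblWeight m))

/-- [cite: Lasserre2009, Lemma 2.4] -/
theorem dblInt_monomial (m : ℕ) (a : MvPolynomial σ ℝ) :
    dblInt (Polynomial.monomial m a) = C (dblWeight m) * a := by
  simp [dblInt, Polynomial.lsum, Polynomial.sum_monomial_index]

/-- [cite: Lasserre2009, Lemma 2.4] -/
theorem dblInt_C (a : MvPolynomial σ ℝ) :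
    dblInt (Polynomial.C a) = C (dblWeight 0) * a := by
  rw [← Polynomial.monomial_zero_left, dblInt_monomial]

/-- `ℝ[X]`-linearity: constants (in `s`) come out of the integral.
[cite: Lasserre2009, Lemma 2.4] -/
theorem dblInt_C_mul (a : MvPolynomial σ ℝ) (p : Polynomial (MvPolynomial σ ℝ)) :
    dblInt (Polynomial.C a * p) = a * dblInt p := by
  rw [Polynomial.C_mul', map_smul, smul_eq_mul]

/-- [cite: Lasserre2009, Lemma 2.4] -/
theorem dblInt_mul_C (a : MvPolynomial σ ℝ) (p : Polynomial (MvPolynomial σ ℝ)) :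
    dblInt (p * Polynomial.C a) = dblInt p * a := by
  rw [mul_comm, dblInt_C_mul, mul_comm]

/-- **Second-order Taylor formula with the double-integral remainder**:
`φ(1) = φ(0) + φ'(0) + ∫₀¹∫₀ᵗ φ''(s) ds dt` for every `φ ∈ ℝ[X][s]` (coefficientwise: the
monomial `a s^m`, `m ≥ 2`, contributes `a·m(m−1)/((m−1)m) = a`).
[cite: Lasserre2009, Lemma 2.5] -/
theorem eval_one_eq_taylor (φ : Polynomial (MvPolynomial σ ℝ)) :
    φ.eval 1 = φ.eval 0 + (Polynomial.derivative φ).eval 0 +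
      dblInt (Polynomial.derivative (Polynomial.derivative φ)) := by
  induction φ using Polynomial.induction_on' with
  | add p q hp hq =>
    simp only [Polynomial.eval_add, map_add, hp, hq]
    ring
  | monomial m a =>
    rcases m with _ | _ | m
    · simp
    · simp
    · simp only [Polynomial.eval_monomial, one_pow, mul_one, Polynomial.derivative_monomial_succ,
        dblInt_monomial]
      rw [zero_pow (by omega), zero_pow (by omega), mul_zero, mul_zero, zero_add, zero_add]
      have hw : (C (dblWeight m) : MvPolynomial σ ℝ) * (((m : MvPolynomial σ ℝ) + 1 + 1) *
          ((m : MvPolynomial σ ℝ) + 1)) = 1 := by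
        rw [show ((m : MvPolynomial σ ℝ) + 1 + 1) * ((m : MvPolynomial σ ℝ) + 1) =
          C ((((m : ℝ) + 1) + 1) * ((m : ℝ) + 1)) by simp [map_natCast], ← C_mul, ← C_1]
        congr 1
        unfold dblWeight
        have h2 : ((m : ℝ) + 1) ≠ 0 := by positivity
        have h3 : ((m : ℝ) + 2) ≠ 0 := by positivity
        field_simp
        ring
      calc a = C (dblWeight m) * (((m : MvPolynomial σ ℝ) + 1 + 1) *
            ((m : MvPolynomial σ ℝ) + 1)) * a := by rw [hw, one_mul]
        _ = _ := by push_cast; ring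

/-! ### §2 The line substitution `f ↦ f(u + s(X − u))` and its `s`-derivatives -/

/-- `X_i ↦ u_i + s·(X_i − u_i)`: the polynomial `f(u + s(X − u)) ∈ ℝ[X][s]`.
[cite: Lasserre2009, Lemma 2.4] -/
def lineSubst (u : σ → ℝ) : MvPolynomial σ ℝ →ₐ[ℝ] Polynomial (MvPolynomial σ ℝ) :=
  aeval fun i => Polynomial.C (C (u i)) + Polynomial.X * Polynomial.C (X i - C (u i))

/-- [cite: Lasserre2009, Lemma 2.4] -/
theorem lineSubst_X (u : σ → ℝ) (i : σ) :
    lineSubst u (X i) = Polynomial.C (C (u i)) + Polynomial.X * Polynomial.C (X i - C (u i)) :=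
  aeval_X _ i

/-- [cite: Lasserre2009, Lemma 2.4] -/
theorem lineSubst_C (u : σ → ℝ) (a : ℝ) : lineSubst u (C a) = Polynomial.C (C a) := by
  rw [lineSubst, aeval_C, Polynomial.algebraMap_apply, MvPolynomial.algebraMap_eq]

/-- At `s = 1` the line substitution is the identity: `f(u + 1·(X − u)) = f(X)`.
[cite: Lasserre2009, Lemma 2.5] -/
theorem eval_one_lineSubst (u : σ → ℝ) (f : MvPolynomial σ ℝ) : (lineSubst u f).eval 1 = f := by
  set ψ : Polynomial (MvPolynomial σ ℝ) →ₐ[ℝ] MvPolynomial σ ℝ :=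
    (Polynomial.aeval (R := MvPolynomial σ ℝ) (1 : MvPolynomial σ ℝ)).restrictScalars ℝ with hψ
  have hψ' : ∀ φ, ψ φ = φ.eval 1 := fun φ => by
    simp only [hψ, AlgHom.coe_restrictScalars', Polynomial.coe_aeval_eq_eval]
  have hcomp : ψ.comp (lineSubst u) = AlgHom.id ℝ _ := by
    refine MvPolynomial.algHom_ext fun i => ?_
    rw [AlgHom.comp_apply, lineSubst_X, hψ', AlgHom.id_apply]
    simp
  have := congrArg (fun χ : MvPolynomial σ ℝ →ₐ[ℝ] MvPolynomial σ ℝ => χ f) hcomp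
  simpa [hψ'] using this

/-- At `s = 0`: `f(u + 0·(X − u)) = f(u)` (a constant polynomial).
[cite: Lasserre2009, Lemma 2.5] -/
theorem eval_zero_lineSubst (u : σ → ℝ) (f : MvPolynomial σ ℝ) :
    (lineSubst u f).eval 0 = C (eval u f) := by
  set ψ : Polynomial (MvPolynomial σ ℝ) →ₐ[ℝ] MvPolynomial σ ℝ :=
    (Polynomial.aeval (R := MvPolynomial σ ℝ) (0 : MvPolynomial σ ℝ)).restrictScalars ℝ with hψ
  have hψ' : ∀ φ, ψ φ = φ.eval 0 := fun φ => by
    simp only [hψ, AlgHom.coe_restrictScalars', Polynomial.coe_aeval_eq_eval]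
  set χ : MvPolynomial σ ℝ →ₐ[ℝ] MvPolynomial σ ℝ :=
    (Algebra.ofId ℝ (MvPolynomial σ ℝ)).comp (aeval u) with hχ
  have hχ' : ∀ g, χ g = C (eval u g) := fun g => by
    simp only [hχ, AlgHom.comp_apply, Algebra.ofId_apply, MvPolynomial.algebraMap_eq]
    rfl
  have hcomp : ψ.comp (lineSubst u) = χ := by
    refine MvPolynomial.algHom_ext fun i => ?_
    rw [AlgHom.comp_apply, lineSubst_X, hψ', hχ']
    simp
  have := congrArg (fun χ : MvPolynomial σ ℝ →ₐ[ℝ] MvPolynomial σ ℝ => χ f) hcomp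
  simpa [hψ', hχ'] using this

/-- The direction `X − u` as a vector of (constant-in-`s`) polynomials. [cite: Lasserre2009, Lemma 2.5] -/
def dir (u : σ → ℝ) (i : σ) : MvPolynomial σ ℝ := X i - C (u i)

/-- [cite: Lasserre2009, Lemma 2.5] -/
@[simp] theorem eval_dir (u x : σ → ℝ) (i : σ) : eval x (dir u i) = x i - u i := by
  simp [dir]

variable [Fintype σ]

/-- **Chain rule along the line**: `(d/ds) f(u + s(X − u)) = Σ_i (∂_i f)(u + s(X − u))·(X_i − u_i)`.
[cite: Lasserre2009, Lemma 2.5] -/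
theorem derivative_lineSubst (u : σ → ℝ) (f : MvPolynomial σ ℝ) :
    Polynomial.derivative (lineSubst u f) =
      ∑ i, lineSubst u (pderiv i f) * Polynomial.C (dir u i) := by
  classical
  induction f using MvPolynomial.induction_on with
  | C a =>
    simp
  | add p q hp hq =>
    simp only [map_add, hp, hq, add_mul, Finset.sum_add_distrib]
  | mul_X p i hp =>
    have hXd : Polynomial.derivative (lineSubst u (X i)) = Polynomial.C (dir u i) := by
      rw [lineSubst_X]
      simp [dir]
    rw [map_mul, Polynomial.derivative_mul, hp, hXd]
    simp only [pderiv_mul, map_add, map_mul, add_mul, Finset.sum_add_distrib]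
    congr 1
    · rw [Finset.sum_mul]
      refine Finset.sum_congr rfl fun j _ => ?_
      ring
    · rw [Finset.sum_eq_single i]
      · rw [pderiv_X]
        simp
      · intro j _ hji
        rw [pderiv_X, Pi.single_eq_of_ne hji.symm]
        simp
      · intro h
        exact absurd (Finset.mem_univ i) h

/-- The second `s`-derivative: `(d²/ds²) f(u + s(X − u)) = Σ_i Σ_j (∂_j ∂_i f)(u + s(X−u))·(X_j − u_j)(X_i − u_i)`.
[cite: Lasserre2009, Lemma 2.5] -/
theorem derivative_derivative_lineSubst (u : σ → ℝ) (f : MvPolynomial σ ℝ) :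
    Polynomial.derivative (Polynomial.derivative (lineSubst u f)) =
      ∑ i, ∑ j, lineSubst u (pderiv j (pderiv i f)) * Polynomial.C (dir u j) *
        Polynomial.C (dir u i) := by
  rw [derivative_lineSubst, Polynomial.derivative_sum]
  refine Finset.sum_congr rfl fun i _ => ?_
  rw [Polynomial.derivative_mul, Polynomial.derivative_C, mul_zero, add_zero,
    derivative_lineSubst, Finset.sum_mul]

/-! ### §3 Lemma 2.5: the Taylor formula with the integrated Hessian -/

/-- `F(X, u) = ∫₀¹∫₀ᵗ ∇²f(u + s(X − u)) ds dt`, entrywise (`hessian f u v = ∂_u ∂_v f`).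
[cite: Lasserre2009, Lemma 2.5] -/
def taylorMatrix (f : MvPolynomial σ ℝ) (u : σ → ℝ) : Matrix σ σ (MvPolynomial σ ℝ) :=
  ((hessian f).map (lineSubst u)).map dblInt

/-- ★ **Lemma 2.5 (Helton–Nie).** `f(X) = f(u) + ∇f(u)ᵀ(X − u) + (X − u)ᵀ F(X,u) (X − u)` with
`F(X,u) = ∫₀¹∫₀ᵗ ∇²f(u + s(X − u)) ds dt`, as an identity in `ℝ[X]` for every `u ∈ ℝⁿ`.
[cite: Lasserre2009, Lemma 2.5] -/
theorem eq_taylor_hessian (f : MvPolynomial σ ℝ) (u : σ → ℝ) :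
    f = C (eval u f) + ∑ i, C (eval u (pderiv i f)) * dir u i +
      dir u ⬝ᵥ (taylorMatrix f u *ᵥ dir u) := by
  have h := eval_one_eq_taylor (lineSubst u f)
  rw [eval_one_lineSubst, eval_zero_lineSubst, derivative_derivative_lineSubst,
    derivative_lineSubst] at h
  conv_lhs => rw [h]
  congr 1
  · congr 1
    rw [Polynomial.eval_finsetSum]
    refine Finset.sum_congr rfl fun i _ => ?_
    rw [Polynomial.eval_mul, Polynomial.eval_C, eval_zero_lineSubst]
  · rw [Finset.sum_comm, map_sum, dotProduct]
    refine Finset.sum_congr rfl fun i _ => ?_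
    rw [map_sum, mulVec, dotProduct, Finset.mul_sum]
    refine Finset.sum_congr rfl fun j _ => ?_
    rw [dblInt_mul_C, dblInt_mul_C, taylorMatrix, Matrix.map_apply, Matrix.map_apply,
      hessian_apply]
    ring

/-! ### §4 Lemma 2.4: integrating an SOS-matrix along the line gives an SOS-matrix -/

/-- The moment matrix `H_{kl} = 1/((k+l+1)(k+l+2)) = ∫₀¹ (1 − s) s^{k+l} ds` (`k, l < n`).
[cite: Lasserre2009, Lemma 2.4] -/
def dblWeightMatrix (n : ℕ) : Matrix (Fin n) (Fin n) ℝ :=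
  Matrix.of fun k l => dblWeight (k.val + l.val)

/-- `H` is positive semidefinite: `cᵀ H c = ∫₀¹ (1 − s) (Σ_k c_k s^k)² ds ≥ 0`.
[cite: Lasserre2009, Lemma 2.4] -/
theorem posSemidef_dblWeightMatrix (n : ℕ) : (dblWeightMatrix n).PosSemidef := by
  refine Matrix.PosSemidef.of_dotProduct_mulVec_nonneg ?_ fun c => ?_
  · show (dblWeightMatrix n)ᴴ = dblWeightMatrix n
    rw [conjTranspose_eq_transpose_of_trivial]
    ext k l
    simp [dblWeightMatrix, add_comm]
  · have hstar : star c = c := star_trivial c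
    rw [hstar]
    have hsq : ∀ s : ℝ, (1 - s) * (∑ k : Fin n, c k * s ^ k.val) ^ 2 =
        ∑ k : Fin n, ∑ l : Fin n, c k * c l * ((1 - s) * s ^ (k.val + l.val)) := by
      intro s
      rw [sq, Finset.sum_mul_sum, Finset.mul_sum]
      refine Finset.sum_congr rfl fun k _ => ?_
      rw [Finset.mul_sum]
      refine Finset.sum_congr rfl fun l _ => ?_
      rw [pow_add]
      ring
    have key : c ⬝ᵥ dblWeightMatrix n *ᵥ c =
        ∫ s in (0 : ℝ)..1, (1 - s) * (∑ k : Fin n, c k * s ^ k.val) ^ 2 := by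
      simp_rw [hsq]
      rw [intervalIntegral.integral_finsetSum fun k _ =>
        (continuous_finsetSum _ fun l _ => by fun_prop).intervalIntegrable _ _]
      simp only [dotProduct, mulVec, dblWeightMatrix, Matrix.of_apply, Finset.mul_sum]
      refine Finset.sum_congr rfl fun k _ => ?_
      rw [intervalIntegral.integral_finsetSum fun l _ =>
        (by fun_prop : Continuous fun s : ℝ => c k * c l * ((1 - s) * s ^ (k.val + l.val))).intervalIntegrable _ _]
      refine Finset.sum_congr rfl fun l _ => ?_
      rw [intervalIntegral.integral_const_mul, integral_one_sub_mul_pow]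
      ring
    rw [key]
    exact intervalIntegral.integral_nonneg zero_le_one fun s hs =>
      mul_nonneg (by linarith [hs.2]) (sq_nonneg _)

/-- `H = Gᵀ G` for some real matrix `G`. [cite: Lasserre2009, Lemma 2.4] -/
theorem exists_dblWeightMatrix_eq_transpose_mul (n : ℕ) :
    ∃ G : Matrix (Fin n) (Fin n) ℝ, dblWeightMatrix n = Gᵀ * G := by
  obtain ⟨G, hG⟩ :=
    CStarAlgebra.nonneg_iff_eq_star_mul_self.mp (posSemidef_dblWeightMatrix n).nonneg
  refine ⟨G, ?_⟩
  rw [hG, star_eq_conjTranspose, conjTranspose_eq_transpose_of_trivial]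

omit [Fintype σ] in
/-- The algebra behind Lemma 2.4: for any family of matrices `B_k` over `ℝ[X]`,
`Σ_{k,l<n} H_{kl} B_kᵀ B_l = Σ_c (Σ_k G_{ck} B_k)ᵀ (Σ_k G_{ck} B_k)` is an SOS-matrix.
[cite: Lasserre2009, Lemma 2.4] -/
theorem isSosMatrix_sum_dblWeight {ρ r : Type*} [Fintype ρ] [Fintype r] (n : ℕ)
    (Bk : ℕ → Matrix ρ r (MvPolynomial σ ℝ)) :
    IsSosMatrix (∑ k : Fin n, ∑ l : Fin n,
      (C (dblWeight (k.val + l.val)) : MvPolynomial σ ℝ) • ((Bk k)ᵀ * Bk l)) := by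
  obtain ⟨G, hG⟩ := exists_dblWeightMatrix_eq_transpose_mul n
  have hkl : ∀ k l : Fin n, dblWeight (k.val + l.val) = ∑ c, G c k * G c l := by
    intro k l
    have := congrFun (congrFun hG k) l
    simpa [dblWeightMatrix, Matrix.mul_apply] using this
  have hre : (∑ k : Fin n, ∑ l : Fin n,
      (C (dblWeight (k.val + l.val)) : MvPolynomial σ ℝ) • ((Bk k)ᵀ * Bk l)) =
      ∑ c : Fin n, (∑ k : Fin n, (C (G c k) : MvPolynomial σ ℝ) • Bk k)ᵀ *
        (∑ l : Fin n, (C (G c l) : MvPolynomial σ ℝ) • Bk l) := by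
    have hR : ∀ c : Fin n, (∑ k : Fin n, (C (G c k) : MvPolynomial σ ℝ) • Bk k)ᵀ *
        (∑ l : Fin n, (C (G c l) : MvPolynomial σ ℝ) • Bk l) =
        ∑ k : Fin n, ∑ l : Fin n,
          ((C (G c k) : MvPolynomial σ ℝ) * C (G c l)) • ((Bk k)ᵀ * Bk l) := by
      intro c
      rw [Matrix.transpose_sum, Matrix.sum_mul]
      refine Finset.sum_congr rfl fun k _ => ?_
      rw [Matrix.mul_sum]
      refine Finset.sum_congr rfl fun l _ => ?_
      rw [transpose_smul, Matrix.smul_mul, Matrix.mul_smul, smul_smul]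
    simp_rw [hR]
    conv_rhs => rw [Finset.sum_comm]
    refine Finset.sum_congr rfl fun k _ => ?_
    conv_rhs => rw [Finset.sum_comm]
    refine Finset.sum_congr rfl fun l _ => ?_
    rw [hkl, map_sum, Finset.sum_smul]
    refine Finset.sum_congr rfl fun c _ => ?_
    rw [map_mul]
  rw [hre]
  exact IsSosMatrix.sum _ fun c _ => isSosMatrix_transpose_mul_self _

omit [Fintype σ] in
/-- Expanding `∫₀¹∫₀ᵗ Bᵀ(s) B(s)` by the coefficients `B(s) = Σ_k s^k B_k`:
`∫₀¹∫₀ᵗ (BᵀB)(s) ds dt = Σ_{k,l<n} H_{kl} B_kᵀ B_l` when all entries of `B` have degree `< n`.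
[cite: Lasserre2009, Lemma 2.4] -/
theorem map_dblInt_transpose_mul_self {ρ r : Type*} [Fintype ρ] [Fintype r]
    (B : Matrix ρ r (Polynomial (MvPolynomial σ ℝ))) (n : ℕ)
    (hn : ∀ t j, (B t j).natDegree < n) :
    (Bᵀ * B).map dblInt = ∑ k : Fin n, ∑ l : Fin n,
      (C (dblWeight (k.val + l.val)) : MvPolynomial σ ℝ) •
        ((B.map fun p => p.coeff k)ᵀ * B.map fun p => p.coeff l) := by
  ext i j : 1
  have hentry : ((Bᵀ * B).map dblInt) i j = ∑ t, dblInt (B t i * B t j) := by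
    simp only [Matrix.map_apply, Matrix.mul_apply, Matrix.transpose_apply, map_sum]
  have hprod : ∀ t, dblInt (B t i * B t j) = ∑ k : Fin n, ∑ l : Fin n,
      C (dblWeight (k.val + l.val)) * ((B t i).coeff k * (B t j).coeff l) := by
    intro t
    conv_lhs => rw [Polynomial.as_sum_range' (B t i) n (hn t i),
      Polynomial.as_sum_range' (B t j) n (hn t j)]
    rw [Finset.sum_mul_sum, map_sum, Finset.sum_range]
    refine Finset.sum_congr rfl fun k _ => ?_
    rw [map_sum, Finset.sum_range]
    refine Finset.sum_congr rfl fun l _ => ?_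
    rw [Polynomial.monomial_mul_monomial, dblInt_monomial]
  rw [hentry]
  simp_rw [hprod]
  simp only [Matrix.sum_apply, Matrix.smul_apply, Matrix.mul_apply, Matrix.transpose_apply,
    Matrix.map_apply, smul_eq_mul, Finset.mul_sum]
  exact Finset.sum_comm.trans (Finset.sum_congr rfl fun k _ => Finset.sum_comm)

omit [Fintype σ] in
/-- ★ **Lemma 2.4 (Helton–Nie).** «If a symmetric matrix polynomial `P ∈ ℝ[X]^{r×r}` is SOS then
for any `u ∈ ℝⁿ`, the double integral `X ↦ F(X,u) := ∫₀¹∫₀ᵗ P(u + s(X − u)) ds dt` is also a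
symmetric SOS matrix polynomial.» [cite: Lasserre2009, Lemma 2.4] -/
theorem isSosMatrix_dblInt_lineSubst {r : Type*} [Fintype r] {P : Matrix r r (MvPolynomial σ ℝ)}
    (hP : IsSosMatrix P) (u : σ → ℝ) : IsSosMatrix ((P.map (lineSubst u)).map dblInt) := by
  obtain ⟨s, A, rfl⟩ := hP
  set B : Matrix (Fin s) r (Polynomial (MvPolynomial σ ℝ)) := A.map (lineSubst u) with hB
  have hAB : (Aᵀ * A).map (lineSubst u) = Bᵀ * B := by
    rw [hB, ← Matrix.transpose_map]
    exact Matrix.map_mul (f := (lineSubst u).toRingHom)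
  rw [hAB]
  -- a common strict degree bound
  set n : ℕ := 1 + ∑ t, ∑ j, (B t j).natDegree with hndef
  have hn : ∀ t j, (B t j).natDegree < n := by
    intro t j
    have h1 : (B t j).natDegree ≤ ∑ j', (B t j').natDegree :=
      Finset.single_le_sum (f := fun j' => (B t j').natDegree) (fun _ _ => Nat.zero_le _)
        (Finset.mem_univ j)
    have h2 : ∑ j', (B t j').natDegree ≤ ∑ t', ∑ j', (B t' j').natDegree :=
      Finset.single_le_sum (f := fun t' => ∑ j', (B t' j').natDegree) (fun _ _ => Nat.zero_le _)
        (Finset.mem_univ t)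
    omega
  rw [map_dblInt_transpose_mul_self B n hn]
  exact isSosMatrix_sum_dblWeight n fun k => B.map fun p => p.coeff k

/-! ### §5 Lemma 2.5's conclusion and Theorem 2.6 (Jensen's inequality for SOS-convex polynomials) -/

/-- For SOS-convex `f`, `F(X,u) = ∫₀¹∫₀ᵗ ∇²f(u + s(X−u))` is an SOS-matrix.
[cite: Lasserre2009, Lemma 2.4 and Lemma 2.5] -/
theorem _root_.Literature.Algebra.Polynomial.SosConvexHessian.IsSosConvex.isSosMatrix_taylorMatrix {f : MvPolynomial σ ℝ} (hf : IsSosConvex f)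
    (u : σ → ℝ) : IsSosMatrix (taylorMatrix f u) :=
  isSosMatrix_dblInt_lineSubst hf u

/-- ★★ For SOS-convex `f` and every `u ∈ ℝⁿ`, the Taylor remainder
`f(X) − f(u) − ∇f(u)ᵀ(X − u) = (X−u)ᵀ F(X,u) (X−u)` is a sum of squares of polynomials (the
polynomial `Δ ∈ Σ²[X]` of the proof of Theorem 2.6). [cite: Lasserre2009, Lemma 2.5 and proof of Theorem 2.6] -/
theorem _root_.Literature.Algebra.Polynomial.SosConvexHessian.IsSosConvex.isSumSq_taylorRemainder {f : MvPolynomial σ ℝ} (hf : IsSosConvex f)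
    (u : σ → ℝ) : IsSumSq (f - C (eval u f) - ∑ i, C (eval u (pderiv i f)) * dir u i) := by
  have h := eq_taylor_hessian f u
  have hre : f - C (eval u f) - ∑ i, C (eval u (pderiv i f)) * dir u i =
      dir u ⬝ᵥ (taylorMatrix f u *ᵥ dir u) := by
    linear_combination h
  rw [hre]
  exact (hf.isSosMatrix_taylorMatrix u).isSumSq_dotProduct_mulVec _

/-- ★ **Lemma 2.5, conclusion.** «if `f` is SOS-convex and `f(u) = 0`, `∇f(u) = 0`, then `f` is a
SOS polynomial.» [cite: Lasserre2009, Lemma 2.5] -/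
theorem _root_.Literature.Algebra.Polynomial.SosConvexHessian.IsSosConvex.isSumSq_of_eval_eq_zero {f : MvPolynomial σ ℝ} (hf : IsSosConvex f)
    {u : σ → ℝ} (h0 : eval u f = 0) (h1 : ∀ i, eval u (pderiv i f) = 0) : IsSumSq f := by
  simpa [h0, h1] using hf.isSumSq_taylorRemainder u

omit [Fintype σ] in
/-- A linear functional with `L(1) = 1` fixes constants. [cite: Lasserre2009, proof of Theorem 2.6] -/
theorem apply_C_of_map_one {L : MvPolynomial σ ℝ →ₗ[ℝ] ℝ} (hL1 : L 1 = 1) (a : ℝ) :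
    L (C a) = a := by
  rw [show (C a : MvPolynomial σ ℝ) = a • (1 : MvPolynomial σ ℝ) by
    rw [Algebra.smul_def, mul_one, MvPolynomial.algebraMap_eq], map_smul, hL1, smul_eq_mul,
    mul_one]

/-- ★★ **Theorem 2.6 (Jensen's inequality for SOS-convex polynomials).** For SOS-convex `f` and a
linear functional `L` on `ℝ[X]` with `L(1) = 1` which is nonnegative on sums of squares
(the printed `y₀ = 1`, `M(y) ⪰ 0`): `L(f) ≥ f(L(X₁), …, L(Xₙ))`.  (Printed for the truncated
functional `M_d(y) ⪰ 0`, `f ∈ ℝ[X]_{2d}`; see the module docstring.)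
[cite: Lasserre2009, Theorem 2.6] -/
theorem _root_.Literature.Algebra.Polynomial.SosConvexHessian.IsSosConvex.jensen {f : MvPolynomial σ ℝ} (hf : IsSosConvex f)
    (L : MvPolynomial σ ℝ →ₗ[ℝ] ℝ) (hL1 : L 1 = 1) (hL : ∀ q, IsSumSq q → 0 ≤ L q) :
    eval (fun i => L (X i)) f ≤ L f := by
  have hrem := hL _ (hf.isSumSq_taylorRemainder fun i => L (X i))
  have hlin : L (∑ i, C (eval (fun i => L (X i)) (pderiv i f)) * dir (fun i => L (X i)) i) = 0 := by
    rw [map_sum]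
    refine Finset.sum_eq_zero fun i _ => ?_
    rw [dir, mul_sub, ← C_mul, map_sub, apply_C_of_map_one hL1,
      show C (eval (fun i => L (X i)) (pderiv i f)) * (X i : MvPolynomial σ ℝ) =
        (eval (fun i => L (X i)) (pderiv i f)) • (X i : MvPolynomial σ ℝ) by
        rw [Algebra.smul_def, MvPolynomial.algebraMap_eq], map_smul, smul_eq_mul, sub_self]
  rw [map_sub, map_sub, apply_C_of_map_one hL1, hlin, sub_zero, sub_nonneg] at hrem
  exact hrem

/-! ### §6 Theorem 3.3 (a): exactness of the first relaxation for SOS-convex programs -/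

/-- Lasserre's cone `Q_c(g) = {σ₀ + Σ_j λ_j g_j : σ₀ ∈ Σ²[X], λ_j ≥ 0}` — «a convex (weak) version
of … Putinar's Positivstellensatz where one replaces the quadratic module `Q(g)` with its subset
`Q_c(g)`». [cite: Lasserre2009, §3.1 (the cone Q_c(g)) and Theorem 3.3] -/
def convexCone {ι : Type*} [Fintype ι] (g : ι → MvPolynomial σ ℝ) : Set (MvPolynomial σ ℝ) :=
  {p | ∃ (s₀ : MvPolynomial σ ℝ) (lam : ι → ℝ), IsSumSq s₀ ∧ (∀ j, 0 ≤ lam j) ∧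
    p = s₀ + ∑ j, C (lam j) * g j}

omit [Fintype σ] in
/-- A nonnegative constant polynomial is a square. [folklore] -/
private theorem isSumSq_C_of_nonneg {a : ℝ} (ha : 0 ≤ a) : IsSumSq (C a : MvPolynomial σ ℝ) := by
  rw [show (C a : MvPolynomial σ ℝ) = C (Real.sqrt a) * C (Real.sqrt a) by
    rw [← C_mul, Real.mul_self_sqrt ha]]
  exact IsSumSq.mul_self _

omit [Fintype σ] in
/-- `Q_c(g) ⊆ Q(g)` (the tree's `quadraticModule`: nonnegative scalars are sums of squares).
[cite: Lasserre2009, §3.1 (Q_c(g) ⊂ Q(g))] -/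
theorem convexCone_subset_quadraticModule {ι : Type*} [Fintype ι] (g : ι → MvPolynomial σ ℝ) :
    convexCone g ⊆ quadraticModule g := by
  rintro p ⟨s₀, lam, hs₀, hlam, rfl⟩
  exact ⟨s₀, fun j => C (lam j), hs₀, fun j => isSumSq_C_of_nonneg (hlam j), rfl⟩

omit [Fintype σ] in
/-- [cite: Lasserre2009, Definition 2.3] -/
theorem hessian_neg (f : MvPolynomial σ ℝ) : hessian (-f) = -hessian f := by
  ext u v
  simp [hessian_apply]

omit [Fintype σ] in
/-- [cite: Lasserre2009, Definition 2.3] -/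
theorem hessian_sum {ι : Type*} (s : Finset ι) (f : ι → MvPolynomial σ ℝ) :
    hessian (∑ j ∈ s, f j) = ∑ j ∈ s, hessian (f j) := by
  ext u v
  simp [hessian_apply, map_sum, Matrix.sum_apply]

omit [Fintype σ] in
/-- [cite: Lasserre2009, Definition 2.3] -/
theorem hessian_C_mul (a : ℝ) (f : MvPolynomial σ ℝ) :
    hessian (C a * f) = (C a : MvPolynomial σ ℝ) • hessian f := by
  ext u v
  simp [hessian_apply]

omit [Fintype σ] in
/-- The Hessian of a constant vanishes. [cite: Lasserre2009, Definition 2.3] -/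
theorem hessian_C (a : ℝ) : hessian (C a : MvPolynomial σ ℝ) = 0 := by
  ext u v
  simp [hessian_apply]

/-- SOS-convexity is preserved under sums. [cite: Lasserre2009, Definition 2.3] -/
theorem _root_.Literature.Algebra.Polynomial.SosConvexHessian.IsSosConvex.add {f g : MvPolynomial σ ℝ} (hf : IsSosConvex f) (hg : IsSosConvex g) :
    IsSosConvex (f + g) := by
  unfold IsSosConvex
  -- `hessian (f + g) = hessian f + hessian g` (the tree's
  -- `Literature.Combinatorics.LorentzianPolynomials.hessian_add` states this for its own copy of the
  -- Hessian; a one-line computation here)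
  rw [show hessian (f + g) = hessian f + hessian g by ext u v; simp [hessian_apply]]
  exact IsSosMatrix.add hf hg

/-- … under nonnegative scalings. [cite: Lasserre2009, Definition 2.3] -/
theorem _root_.Literature.Algebra.Polynomial.SosConvexHessian.IsSosConvex.const_mul {f : MvPolynomial σ ℝ} (hf : IsSosConvex f) {a : ℝ} (ha : 0 ≤ a) :
    IsSosConvex (C a * f) := by
  unfold IsSosConvex
  rw [hessian_C_mul]
  exact IsSosMatrix.smul (isSumSq_C_of_nonneg ha) hf

/-- … under finite sums. [cite: Lasserre2009, Definition 2.3] -/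
theorem _root_.Literature.Algebra.Polynomial.SosConvexHessian.IsSosConvex.sum {ι : Type*} (s : Finset ι) {f : ι → MvPolynomial σ ℝ}
    (h : ∀ j ∈ s, IsSosConvex (f j)) : IsSosConvex (∑ j ∈ s, f j) := by
  unfold IsSosConvex
  rw [hessian_sum]
  exact IsSosMatrix.sum s h

omit [Fintype σ] in
/-- … and by adding constants. [cite: Lasserre2009, Definition 2.3] -/
theorem _root_.Literature.Algebra.Polynomial.SosConvexHessian.IsSosConvex.add_C {f : MvPolynomial σ ℝ} (hf : IsSosConvex f) (a : ℝ) :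
    IsSosConvex (f + C a) := by
  unfold IsSosConvex
  rw [show hessian (f + C a) = hessian f + hessian (C a) by ext u v; simp [hessian_apply],
    hessian_C, add_zero]
  exact hf

/-- The Lagrangian `L = f − f(x*) − Σ_j λ_j g_j` of an SOS-convex program (`f`, `−g_j` SOS-convex,
`λ ≥ 0`) is SOS-convex. [cite: Lasserre2009, Theorem 3.3 (proof of (a)) and proof of Theorem 3.4] -/
theorem _root_.Literature.Algebra.Polynomial.SosConvexHessian.IsSosConvex.lagrangian {ι : Type*} [Fintype ι] {f : MvPolynomial σ ℝ} {g : ι → MvPolynomial σ ℝ}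
    (hf : IsSosConvex f) (hg : ∀ j, IsSosConvex (-g j)) {lam : ι → ℝ} (hlam : ∀ j, 0 ≤ lam j)
    (c : ℝ) : IsSosConvex (f - C c - ∑ j, C (lam j) * g j) := by
  have h : f - C c - ∑ j, C (lam j) * g j = f + ∑ j, C (lam j) * (-g j) + C (-c) := by
    rw [map_neg]
    simp only [mul_neg, Finset.sum_neg_distrib]
    ring
  rw [h]
  exact ((hf.add (IsSosConvex.sum _ fun j _ => (hg j).const_mul (hlam j))).add_C _)

/-- ★★ **Theorem 3.3 (a)** [Lasserre 2009]. `f` and `−g_j` SOS-convex (`j ∈ ι` finite); `(x*, λ)` a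
KKT pair: `λ_j ≥ 0`, `λ_j g_j(x*) = 0`, `∇f(x*) = Σ_j λ_j ∇g_j(x*)` (for the printed hypotheses —
Slater's condition and a minimiser `x* ∈ K` — such a pair exists).  Then
`f − f(x*) ∈ Q_c(g)`: `f − f(x*) = σ₀ + Σ_j λ_j g_j` with `σ₀` a sum of squares (namely the
Lagrangian, SOS by Lemma 2.5). [cite: Lasserre2009, Theorem 3.3 (a)] -/
theorem _root_.Literature.Algebra.Polynomial.SosConvexHessian.IsSosConvex.sub_C_mem_convexCone_of_kkt {ι : Type*} [Fintype ι] {f : MvPolynomial σ ℝ}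
    {g : ι → MvPolynomial σ ℝ} (hf : IsSosConvex f) (hg : ∀ j, IsSosConvex (-g j))
    (x : σ → ℝ) (lam : ι → ℝ) (hlam : ∀ j, 0 ≤ lam j) (hcompl : ∀ j, lam j * eval x (g j) = 0)
    (hstat : ∀ i, eval x (pderiv i f) = ∑ j, lam j * eval x (pderiv i (g j))) :
    f - C (eval x f) ∈ convexCone g := by
  set Lag : MvPolynomial σ ℝ := f - C (eval x f) - ∑ j, C (lam j) * g j with hLag
  have hL : IsSosConvex Lag := hf.lagrangian hg hlam _
  have hL0 : eval x Lag = 0 := by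
    simp only [hLag, map_sub, map_sum, map_mul, eval_C, hcompl, Finset.sum_const_zero,
      sub_self]
  have hL1 : ∀ i, eval x (pderiv i Lag) = 0 := by
    intro i
    simp only [hLag, map_sub, map_sum, pderiv_C, sub_zero, pderiv_mul, zero_mul, zero_add,
      map_mul, eval_C, hstat, sub_self]
  refine ⟨Lag, lam, hL.isSumSq_of_eval_eq_zero hL0 hL1, hlam, ?_⟩
  rw [hLag]
  ring

/-- Consequently `f − f(x*) ∈ Q(g)` (a Putinar certificate of order `⌈deg/2⌉` with CONSTANT
multipliers) … [cite: Lasserre2009, Theorem 3.3] -/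
theorem _root_.Literature.Algebra.Polynomial.SosConvexHessian.IsSosConvex.sub_C_mem_quadraticModule_of_kkt {ι : Type*} [Fintype ι] {f : MvPolynomial σ ℝ}
    {g : ι → MvPolynomial σ ℝ} (hf : IsSosConvex f) (hg : ∀ j, IsSosConvex (-g j))
    (x : σ → ℝ) (lam : ι → ℝ) (hlam : ∀ j, 0 ≤ lam j) (hcompl : ∀ j, lam j * eval x (g j) = 0)
    (hstat : ∀ i, eval x (pderiv i f) = ∑ j, lam j * eval x (pderiv i (g j))) :
    f - C (eval x f) ∈ quadraticModule g :=
  convexCone_subset_quadraticModule g (hf.sub_C_mem_convexCone_of_kkt hg x lam hlam hcompl hstat)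

/-- … and the KKT point is a GLOBAL minimiser of `f` on `K = {g_j ≥ 0}`: `f(x*) ≤ f(y)` for every
`y ∈ K` (soundness of the certificate — Theorem 3.3 (b)'s «`x*` is a global minimizer of `f` on
`K`» for the KKT point itself). [cite: Lasserre2009, Theorem 3.3] -/
theorem _root_.Literature.Algebra.Polynomial.SosConvexHessian.IsSosConvex.eval_le_of_kkt {ι : Type*} [Fintype ι] {f : MvPolynomial σ ℝ}
    {g : ι → MvPolynomial σ ℝ} (hf : IsSosConvex f) (hg : ∀ j, IsSosConvex (-g j))
    (x : σ → ℝ) (lam : ι → ℝ) (hlam : ∀ j, 0 ≤ lam j) (hcompl : ∀ j, lam j * eval x (g j) = 0)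
    (hstat : ∀ i, eval x (pderiv i f) = ∑ j, lam j * eval x (pderiv i (g j)))
    {y : σ → ℝ} (hy : y ∈ semialgSet g) : eval x f ≤ eval y f := by
  have h := eval_nonneg_of_mem_quadraticModule
    (hf.sub_C_mem_quadraticModule_of_kkt hg x lam hlam hcompl hstat) hy
  rw [map_sub, eval_C, sub_nonneg] at h
  exact h

end Literature.Algebra.Polynomial.SosConvexExactness
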